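import Literature.NumberTheory.Sieve.GoldstonPintzYildirimLemma3Diag
import HarnessLib

/-!
# Goldston–Pintz–Yıldırım, Lemma 3 — the remaining pieces on the line `Re s₂ = θ`

Trunk: NumberTheory / Sieve, continuing `GoldstonPintzYildirimLemma3Diag` (GPY, *Primes in
tuples I*, §8). With both lines of (8.1) at `Re s₁ = Re s₂ = θ`, write
`Φ(s₂) = ∫ F(θ+it₁, s₂) dt₁`. This file proves: the three functions of `t₂` met on the segment
`s₂ = θ + it₂`, `|t₂| ≤ T` — `Φ`, the diagonal term `r` and the residue `ρ₀` — are
(interval-)integrable, so that the inner decomposition integrates to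
`∫_{−T}^{T} Φ = ∫_{−T}^{T} E_w − I ∫_{−T}^{T} r − I ∫_{−T}^{T} ρ₀` with
`E_w = Φ + I r + I ρ₀ =` (tails + left edge + horizontal edges of the `w`-rectangle); the bound
for `∫ |E_w|`; the truncation bound for `∫_{|t₂|>T} Φ` ((8.6)-type tails); and the bounds for
`ρ₀` on the left edge `Re s₂ = −σ₀` and on the horizontal connectors `Im s₂ = ±T` of the outer
rectangle ((8.16)–(8.19)). Everything here is PROVED.

## References

* D. A. Goldston, J. Pintz, C. Y. Yıldırım, *Primes in tuples. I*, Ann. of Math. (2) 170 (2009),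
  819–862 = arXiv:math/0508185, §8 (8.6)–(8.8), (8.14)–(8.19). [cite: GoldstonPintzYildirim2009]
-/

noncomputable section

open Complex Filter Topology MeasureTheory Set intervalIntegral
open scoped Real Interval

namespace Literature.NumberTheory.Sieve.GPY

open Literature.Analysis.Complex (rectBoundaryIntegral)
open Literature.NumberTheory.LFunctions.Nicolas (zetaOne zetaOne_zero differentiable_zetaOne zetaOne_of_ne_zero)

section Pieces

variable {G : ℂ → ℂ → ℂ} {cbar C : ℝ}

/-! ### Continuity and integrability along `Re s₂ = θ` -/

/-- **`t ↦ r(θ+it)` is continuous on `[−T, T]`** (`4η ≤ θ`, `η + 2θ < 1/4`,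
`η + 2θ ≤ 4c̄/log(T + η + 4)`, `R > 0`). [cite: GoldstonPintzYildirim2009, Section 8 eq. 8.21] -/
theorem continuousOn_diagRes_line
    (hWz : ∀ z : ℂ, z ≠ 0 → -(4 * cbar / Real.log (|z.im| + 3)) ≤ z.re → zetaOne z ≠ 0)
    (hc : 0 ≤ cbar) (hG : DifferentiableOn ℂ (fun z : ℂ × ℂ => G z.1 z.2) G₂Region)
    {R : ℝ} (hR : 0 < R) (a b d u v : ℕ) {η θ T : ℝ} (hη : 0 < η) (hθ : 4 * η ≤ θ)
    (hquarter : η + 2 * θ < 1 / 4) (hzfr : η + 2 * θ ≤ 4 * cbar / Real.log (η + (T + 1) + 3)) :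
    ContinuousOn (fun t : ℝ => diagRes G R a b d u v η ((θ : ℂ) + t * I)) (Icc (-T) T) := by
  have hdiff := differentiableOn_diagRes hWz hc hG hR a b d u v (η := η) (θlo := θ / 2) (Y := 2 * θ)
    (Y' := T + 1) hη (by linarith) hquarter hzfr
  have hUo : IsOpen {s₂ : ℂ | θ / 2 < s₂.re ∧ s₂.re < 2 * θ ∧ |s₂.im| < T + 1} :=
    (isOpen_lt continuous_const Complex.continuous_re).inter
      ((isOpen_lt Complex.continuous_re continuous_const).inter
        (isOpen_lt (continuous_abs.comp Complex.continuous_im) continuous_const))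
  intro t ht
  have hθ0 : 0 < θ := by linarith
  have hmem : ((θ : ℂ) + t * I) ∈ {s₂ : ℂ | θ / 2 < s₂.re ∧ s₂.re < 2 * θ ∧ |s₂.im| < T + 1} := by
    refine ⟨by simp; linarith, by simp; linarith, ?_⟩
    simp only [add_im, ofReal_im, mul_im, ofReal_re, I_im, mul_one, I_re, mul_zero, add_zero, zero_add]
    exact lt_of_le_of_lt (abs_le.2 ⟨ht.1, ht.2⟩) (by linarith)
  have h1 : ContinuousAt (diagRes G R a b d u v η) ((θ : ℂ) + t * I) :=
    (hdiff.differentiableAt (hUo.mem_nhds hmem)).continuousAt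
  have h2 : ContinuousAt (fun t : ℝ => (θ : ℂ) + t * I) t := by fun_prop
  exact (ContinuousAt.comp (f := fun t : ℝ => (θ : ℂ) + t * I) h1 h2).continuousWithinAt

/-- **`t ↦ ρ₀(θ+it)` is continuous** (`0 < η < θ`, `η < 1/8`, `2η ≤ ρ_W`, `R > 0`).
[cite: GoldstonPintzYildirim2009, Section 8 eq. 8.9] -/
theorem continuous_zeroRes_line (hG : DifferentiableOn ℂ (fun z : ℂ × ℂ => G z.1 z.2) G₂Region)
    {ρW : ℝ} (hρ : ∀ s : ℂ, ‖s‖ ≤ ρW → 1 / 2 ≤ ‖zetaOne s‖ ∧ ‖zetaOne s‖ ≤ 3 / 2)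
    {R : ℝ} (hR : 0 < R) (a b d u v : ℕ) {η θ : ℝ} (hη : 0 < η) (hη8 : η < 1 / 8) (hηρ : 2 * η ≤ ρW)
    (hθ : η < θ) : Continuous (fun t : ℝ => zeroRes G R a b d u v η ((θ : ℂ) + t * I)) := by
  have hdiff := differentiableOn_zeroRes hG hρ hR a b d u v hη hη8 hηρ
  refine continuous_iff_continuousAt.2 fun t => ?_
  have hθ0 : 0 < θ := by linarith
  have hmem : ((θ : ℂ) + t * I) ∈ zeroResDomain η := by
    refine ⟨by simp; linarith, zetaOne_ne_zero_of_re_pos (by simp; exact hθ0), Or.inl ?_⟩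
    simp [abs_of_pos hθ0]; exact hθ
  have h1 : ContinuousAt (zeroRes G R a b d u v η) ((θ : ℂ) + t * I) :=
    (hdiff.differentiableAt ((isOpen_zeroResDomain η).mem_nhds hmem)).continuousAt
  have h2 : ContinuousAt (fun t : ℝ => (θ : ℂ) + t * I) t := by fun_prop
  exact ContinuousAt.comp (f := fun t : ℝ => (θ : ℂ) + t * I) h1 h2

/-- `Φ(s₂) = ∫ F(θ + it₁, s₂) dt₁`, the inner integral on the line `Re s₁ = θ`.
[cite: GoldstonPintzYildirim2009, Section 8 eq. 8.7] -/
def lemma3Phi (G : ℂ → ℂ → ℂ) (R : ℝ) (a b d u v : ℕ) (θ : ℝ) (s₂ : ℂ) : ℂ :=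
  ∫ t₁ : ℝ, lemma3F G R a b d u v ((θ : ℂ) + t₁ * I) s₂

/-- **`t₂ ↦ Φ(θ+it₂)` is integrable** (Fubini on the product majorant; `a+u, b+v ≥ 1`,
`0 < θ ≤ 1`, `|G| ≤ B` on the two lines). [cite: GoldstonPintzYildirim2009, Section 8 eq. 8.7] -/
theorem integrable_lemma3Phi_line (hG : DifferentiableOn ℂ (fun z : ℂ × ℂ => G z.1 z.2) G₂Region)
    {R : ℝ} (hR : 0 < R) {a b d u v : ℕ} (hau : 1 ≤ a + u) (hbv : 1 ≤ b + v) {θ B : ℝ}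
    (hθ : 0 < θ) (hθ1 : θ ≤ 1) (hB0 : 0 ≤ B)
    (hGB : ∀ t₁ t₂ : ℝ, ‖G ((θ : ℂ) + t₁ * I) ((θ : ℂ) + t₂ * I)‖ ≤ B) :
    Integrable (fun t₂ : ℝ => lemma3Phi G R a b d u v θ ((θ : ℂ) + t₂ * I)) := by
  have hint := integrable_lemma3F_lines (d := d) hG hR hau hbv hθ hθ1 hθ hθ1 hB0 hGB
  exact hint.integral_prod_right

/-! ### The integrated inner decomposition -/

/-- **The inner decomposition, integrated over `|t₂| ≤ T`**: with
`E_w(t₂) := Φ(θ+it₂) + I r(θ+it₂) + I ρ₀(θ+it₂)`,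
`∫_{−T}^{T} Φ(θ+it₂) dt₂ = ∫_{−T}^{T} E_w − I ∫_{−T}^{T} r(θ+it₂) dt₂ − I ∫_{−T}^{T} ρ₀(θ+it₂) dt₂`
(all three are interval integrable). [cite: GoldstonPintzYildirim2009, Section 8 eq. 8.8] -/
theorem integral_lemma3Phi_eq
    (hWz : ∀ z : ℂ, z ≠ 0 → -(4 * cbar / Real.log (|z.im| + 3)) ≤ z.re → zetaOne z ≠ 0)
    (hc : 0 ≤ cbar) (hG : DifferentiableOn ℂ (fun z : ℂ × ℂ => G z.1 z.2) G₂Region)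
    {ρW : ℝ} (hρ : ∀ s : ℂ, ‖s‖ ≤ ρW → 1 / 2 ≤ ‖zetaOne s‖ ∧ ‖zetaOne s‖ ≤ 3 / 2)
    {R : ℝ} (hR : 0 < R) {a b d u v : ℕ} (hau : 1 ≤ a + u) (hbv : 1 ≤ b + v) {η θ T B : ℝ}
    (hη : 0 < η) (hη8 : η < 1 / 8) (hηρ : 2 * η ≤ ρW) (hθ : 4 * η ≤ θ) (hθ1 : θ ≤ 1)
    (hquarter : η + 2 * θ < 1 / 4) (hzfr : η + 2 * θ ≤ 4 * cbar / Real.log (η + (T + 1) + 3))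
    (hT : 0 ≤ T) (hB0 : 0 ≤ B) (hGB : ∀ t₁ t₂ : ℝ, ‖G ((θ : ℂ) + t₁ * I) ((θ : ℂ) + t₂ * I)‖ ≤ B) :
    ∫ t₂ : ℝ in (-T)..T, lemma3Phi G R a b d u v θ ((θ : ℂ) + t₂ * I) =
      (∫ t₂ : ℝ in (-T)..T, (lemma3Phi G R a b d u v θ ((θ : ℂ) + t₂ * I) +
          I * diagRes G R a b d u v η ((θ : ℂ) + t₂ * I) + I * zeroRes G R a b d u v η ((θ : ℂ) + t₂ * I))) -
        I * (∫ t₂ : ℝ in (-T)..T, diagRes G R a b d u v η ((θ : ℂ) + t₂ * I)) -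
        I * (∫ t₂ : ℝ in (-T)..T, zeroRes G R a b d u v η ((θ : ℂ) + t₂ * I)) := by
  have hθ0 : 0 < θ := by linarith
  have hΦ : IntervalIntegrable (fun t₂ : ℝ => lemma3Phi G R a b d u v θ ((θ : ℂ) + t₂ * I)) volume (-T) T :=
    (integrable_lemma3Phi_line hG hR hau hbv hθ0 hθ1 hB0 hGB).intervalIntegrable
  have hr : IntervalIntegrable (fun t₂ : ℝ => I * diagRes G R a b d u v η ((θ : ℂ) + t₂ * I)) volume (-T) T := by
    refine ((continuousOn_diagRes_line hWz hc hG hR a b d u v hη hθ hquarter hzfr).mono ?_).intervalIntegrable.const_mul I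
    rw [Set.uIcc_of_le (by linarith)]
  have hρ₀ : IntervalIntegrable (fun t₂ : ℝ => I * zeroRes G R a b d u v η ((θ : ℂ) + t₂ * I)) volume (-T) T :=
    ((continuous_zeroRes_line hG hρ hR a b d u v hη hη8 hηρ (by linarith)).intervalIntegrable _ _).const_mul I
  rw [intervalIntegral.integral_add (hΦ.add hr) hρ₀, intervalIntegral.integral_add hΦ hr,
    intervalIntegral.integral_const_mul, intervalIntegral.integral_const_mul]
  ring

/-! ### The error `E_w` of the inner decomposition -/

/-- The coefficient of `1/|s₂|^{v+1+b}` in the bound for `E_w` (tails + left edge + two horizontal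
edges of the `w`-rectangle), `ℓ_w = log(T_w + T + 3)`, `T_w = 2T`.
[cite: GoldstonPintzYildirim2009, Section 8 eq. 8.19] -/
def EwCoef (B C R θ σw T : ℝ) (a b d u : ℕ) : ℝ :=
  2 * (B * (3 / (θ + θ)) ^ d * (2 / θ) ^ a * (C * Real.log (2 * T + T + 3)) ^ b * R ^ (θ + θ) *
      2 ^ (u + 1 + a)) / (2 * T) +
    B * (1 / σw + C * Real.log (2 * T + T + 3)) ^ d * (C * Real.log (2 * T + T + 3)) ^ a *
      (C * Real.log (2 * T + T + 3)) ^ b * R ^ (-σw) * (Real.pi / (σw + θ) ^ (u + a)) +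
    2 * ((θ + θ + σw) * (B * (1 / σw + C * Real.log (2 * T + T + 3)) ^ d *
      (C * Real.log (2 * T + T + 3)) ^ a * (C * Real.log (2 * T + T + 3)) ^ b * R ^ (θ + θ) *
      ((2 * T - T) ^ (u + 1 + a))⁻¹))

/-- **Pointwise bound for `E_w`**: for `s₂ = θ + it₂`, `|t₂| ≤ T` (`T ≥ 1`, `T_w = 2T`),
`|Φ(s₂) + I r(s₂) + I ρ₀(s₂)| ≤ EwCoef / |s₂|^{v+1+b}`, since by the inner decomposition
`Φ + I r + I ρ₀ = (tails) + (left edge) + I (bottom) − I (top)`.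
[cite: GoldstonPintzYildirim2009, Section 8 eq. 8.19] -/
theorem norm_Ew_le
    (hWz : ∀ z : ℂ, z ≠ 0 → -(4 * cbar / Real.log (|z.im| + 3)) ≤ z.re →
      zetaOne z ≠ 0 ∧ ‖(zetaOne z)⁻¹‖ ≤ C * Real.log (|z.im| + 3) / ‖z‖ ∧
        ‖zetaOne z‖ ≤ 1 + C * ‖z‖ * Real.log (|z.im| + 3))
    (hc : 0 ≤ cbar) (hC : 0 ≤ C) {B κ : ℝ} (hB0 : 0 ≤ B) (hκ0 : 0 ≤ κ)
    (hG : DifferentiableOn ℂ (fun z : ℂ × ℂ => G z.1 z.2) G₂Region)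
    (hGB : ∀ s₁ s₂ : ℂ, -κ ≤ s₁.re → s₁.re ≤ 2 → -κ ≤ s₂.re → s₂.re ≤ 2 → ‖G s₁ s₂‖ ≤ B)
    {R : ℝ} (hR : 1 ≤ R) {a b d u v : ℕ} (hau : 1 ≤ a + u) {η θ σw T : ℝ} (hη : 0 < η)
    (hθ : 4 * η ≤ θ) (hθ1 : θ ≤ 1) (hησ : η < σw) (hT : 1 ≤ T)
    (hzfr : σw + θ ≤ 4 * cbar / Real.log (2 * T + T + 3)) (hκ : σw + θ ≤ κ)
    (hquarter : σw + θ < 1 / 4) {t₂ : ℝ} (ht₂ : |t₂| ≤ T) :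
    ‖lemma3Phi G R a b d u v θ ((θ : ℂ) + t₂ * I) + I * diagRes G R a b d u v η ((θ : ℂ) + t₂ * I) +
        I * zeroRes G R a b d u v η ((θ : ℂ) + t₂ * I)‖ ≤
      EwCoef B C R θ σw T a b d u * (‖(θ : ℂ) + t₂ * I‖ ^ (v + 1 + b))⁻¹ := by
  set s₂ : ℂ := (θ : ℂ) + t₂ * I with hs₂def
  have hθ0 : 0 < θ := by linarith
  have hre : s₂.re = θ := by simp [hs₂def]
  have him : s₂.im = t₂ := by simp [hs₂def]
  have hR0 : 0 < R := by linarith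
  have hσw : 0 < σw := by linarith
  -- the pieces
  set g : ℂ → ℂ := lemma3g G R a b d u v s₂ with hgdef
  set c : ℝ := θ + s₂.re with hcdef
  set Afull : ℂ := ∫ τ : ℝ, g (((c : ℝ) : ℂ) + τ * I) with hAfull
  set Aseg : ℂ := ∫ τ : ℝ in (-(2 * T))..(2 * T), g (((c : ℝ) : ℂ) + τ * I) with hAseg
  set Lft : ℂ := ∫ τ : ℝ in (-(2 * T))..(2 * T), g (((-σw : ℝ) : ℂ) + τ * I) with hLft
  set Bot : ℂ := ∫ x : ℝ in (-σw)..c, g ((x : ℂ) + ((-(2 * T) : ℝ) : ℂ) * I) with hBot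
  set Top : ℂ := ∫ x : ℝ in (-σw)..c, g ((x : ℂ) + ((2 * T : ℝ) : ℂ) * I) with hTop
  have hΦ : lemma3Phi G R a b d u v θ s₂ = Afull := by
    rw [lemma3Phi, hAfull, hgdef, hcdef]
    exact integral_lemma3F_eq_integral_lemma3g R a b d u v θ s₂
  have hseg : Aseg = Lft - I * (diagRes G R a b d u v η s₂ + zeroRes G R a b d u v η s₂ - Bot + Top) := by
    rw [hAseg, hLft, hBot, hTop, hgdef, hcdef]
    exact integral_lemma3g_segment_eq (fun z hz hreg => (hWz z hz hreg).1) hc hG hR0 a b d u v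
      (θ := θ) (η := η) (σw := σw) (Tw := 2 * T) (s₂ := s₂) hη (by linarith) (by rw [hre]; linarith)
      hησ (by rw [him]; linarith) (by rw [hre]; exact hquarter)
      (by rw [hre, him]
          refine hzfr.trans (div_le_div_of_nonneg_left (by positivity)
            (Real.log_pos (by linarith [abs_nonneg t₂])) ?_)
          exact Real.log_le_log (by linarith [abs_nonneg t₂]) (by linarith))
  have hid : lemma3Phi G R a b d u v θ s₂ + I * diagRes G R a b d u v η s₂ + I * zeroRes G R a b d u v η s₂ =
      (Afull - Aseg) + Lft + I * Bot - I * Top := by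
    rw [hΦ]
    have : Afull = (Afull - Aseg) + Aseg := by ring
    rw [hseg] at this ⊢
    linear_combination this
  rw [hid]
  -- the four bounds
  have htail : ‖Afull - Aseg‖ ≤ 2 * ((B * (3 / (θ + s₂.re)) ^ d * (2 / θ) ^ a *
      (C * Real.log (2 * T + T + 3)) ^ b * R ^ (θ + s₂.re) * 2 ^ (u + 1 + a) *
      (‖s₂‖ ^ (v + 1 + b))⁻¹) / (2 * T)) := by
    rw [hAfull, hAseg, hgdef, hcdef]
    exact norm_integral_lemma3g_tail_le hWz hc hC hB0 hκ0 hG hGB hR hau (by rw [hre]; exact hθ0)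
      (by rw [hre]; exact hθ1) hθ0 hθ1 (by rw [him]; exact ht₂) hT le_rfl
  have hleft : ‖Lft‖ ≤ B * (1 / σw + C * Real.log (2 * T + T + 3)) ^ d * (C * Real.log (2 * T + T + 3)) ^ a *
      (C * Real.log (2 * T + T + 3)) ^ b * R ^ (-σw) * (Real.pi / (σw + s₂.re) ^ (u + a)) *
      (‖s₂‖ ^ (v + 1 + b))⁻¹ := by
    rw [hLft, hgdef]
    exact norm_integral_lemma3g_left_le hWz hc hC hB0 hGB hR hau (by rw [hre]; exact hθ0)
      (by rw [him]; exact ht₂) (by linarith) (by linarith) hσw (by rw [hre]; exact hzfr)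
      (by rw [hre]; exact hκ) (by rw [hre]; exact hquarter)
  have hhor : ∀ Y : ℝ, |Y| = 2 * T →
      ‖∫ x : ℝ in (-σw)..c, g ((x : ℂ) + (Y : ℂ) * I)‖ ≤
        (θ + s₂.re + σw) * (B * (1 / σw + C * Real.log (2 * T + T + 3)) ^ d *
          (C * Real.log (2 * T + T + 3)) ^ a * (C * Real.log (2 * T + T + 3)) ^ b * R ^ (θ + s₂.re) *
          (((2 * T - T) ^ (u + 1 + a))⁻¹ * (‖s₂‖ ^ (v + 1 + b))⁻¹)) := by
    intro Y hY
    rw [hgdef, hcdef]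
    exact norm_integral_lemma3g_horizontal_le hWz hc hC hB0 hGB hR a b d u v (by rw [hre]; exact hθ0)
      hθ0.le hθ1 (by rw [him]; exact ht₂) (by linarith) (by linarith) hσw (by rw [hre]; exact hzfr)
      (by rw [hre]; exact hκ) (by rw [hre]; exact hquarter) hY
  have hbot := hhor (-(2 * T)) (by rw [abs_neg, abs_of_pos (by linarith)])
  have htop := hhor (2 * T) (abs_of_pos (by linarith))
  rw [hre] at htail hleft hbot htop
  have hI : ‖I‖ = 1 := Complex.norm_I
  calc ‖(Afull - Aseg) + Lft + I * Bot - I * Top‖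
      ≤ ‖(Afull - Aseg) + Lft + I * Bot‖ + ‖I * Top‖ := norm_sub_le _ _
    _ ≤ ‖Afull - Aseg‖ + ‖Lft‖ + ‖I * Bot‖ + ‖I * Top‖ := add_le_add norm_add₃_le le_rfl
    _ = ‖Afull - Aseg‖ + ‖Lft‖ + ‖Bot‖ + ‖Top‖ := by rw [norm_mul, norm_mul, hI, one_mul, one_mul]
    _ ≤ _ := by
        refine (add_le_add (add_le_add (add_le_add htail hleft) hbot) htop).trans (le_of_eq ?_)
        rw [EwCoef]
        ring

/-- **`∫_{−T}^{T} |E_w|`**: `‖∫_{−T}^{T} E_w(t₂) dt₂‖ ≤ EwCoef · π/θ^{v+b}` (`b + v ≥ 1`).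
[cite: GoldstonPintzYildirim2009, Section 8 eq. 8.19] -/
theorem norm_integral_Ew_le
    (hWz : ∀ z : ℂ, z ≠ 0 → -(4 * cbar / Real.log (|z.im| + 3)) ≤ z.re →
      zetaOne z ≠ 0 ∧ ‖(zetaOne z)⁻¹‖ ≤ C * Real.log (|z.im| + 3) / ‖z‖ ∧
        ‖zetaOne z‖ ≤ 1 + C * ‖z‖ * Real.log (|z.im| + 3))
    (hc : 0 ≤ cbar) (hC : 0 ≤ C) {B κ : ℝ} (hB0 : 0 ≤ B) (hκ0 : 0 ≤ κ)
    (hG : DifferentiableOn ℂ (fun z : ℂ × ℂ => G z.1 z.2) G₂Region)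
    (hGB : ∀ s₁ s₂ : ℂ, -κ ≤ s₁.re → s₁.re ≤ 2 → -κ ≤ s₂.re → s₂.re ≤ 2 → ‖G s₁ s₂‖ ≤ B)
    {R : ℝ} (hR : 1 ≤ R) {a b d u v : ℕ} (hau : 1 ≤ a + u) (hbv : 1 ≤ b + v) {η θ σw T : ℝ}
    (hη : 0 < η) (hθ : 4 * η ≤ θ) (hθ1 : θ ≤ 1) (hησ : η < σw) (hT : 1 ≤ T)
    (hzfr : σw + θ ≤ 4 * cbar / Real.log (2 * T + T + 3)) (hκ : σw + θ ≤ κ)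
    (hquarter : σw + θ < 1 / 4) (hE0 : 0 ≤ EwCoef B C R θ σw T a b d u) :
    ‖∫ t₂ : ℝ in (-T)..T, (lemma3Phi G R a b d u v θ ((θ : ℂ) + t₂ * I) +
        I * diagRes G R a b d u v η ((θ : ℂ) + t₂ * I) + I * zeroRes G R a b d u v η ((θ : ℂ) + t₂ * I))‖ ≤
      EwCoef B C R θ σw T a b d u * (Real.pi / θ ^ (v + b)) := by
  have hθ0 : 0 < θ := by linarith
  obtain ⟨hint, hval⟩ := integral_inv_norm_pow_le hθ0 (k := v + b) (by omega)
  set E := EwCoef B C R θ σw T a b d u with hE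
  calc _ ≤ ∫ t₂ : ℝ in (-T)..T, E * (‖(θ : ℂ) + t₂ * I‖ ^ (v + b + 1))⁻¹ := by
        refine intervalIntegral.norm_integral_le_of_norm_le (by linarith) (Eventually.of_forall fun t ht => ?_)
          ((hint.const_mul E).intervalIntegrable)
        have h := norm_Ew_le hWz hc hC hB0 hκ0 hG hGB hR hau (b := b) (d := d) (v := v) hη hθ hθ1 hησ hT hzfr hκ hquarter
          (t₂ := t) (abs_le.2 ⟨ht.1.le, ht.2⟩)
        rwa [show v + 1 + b = v + b + 1 by ring] at h
    _ ≤ ∫ t₂ : ℝ, E * (‖(θ : ℂ) + t₂ * I‖ ^ (v + b + 1))⁻¹ := by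
        rw [intervalIntegral.integral_of_le (by linarith)]
        exact setIntegral_le_integral (hint.const_mul E) (Eventually.of_forall fun t => by positivity)
    _ = E * ∫ t₂ : ℝ, (‖(θ : ℂ) + t₂ * I‖ ^ (v + b + 1))⁻¹ := integral_const_mul _ _
    _ ≤ E * (Real.pi / θ ^ (v + b)) := mul_le_mul_of_nonneg_left hval hE0

/-! ### Truncating the outer integral: `E_t` -/

/-- **Pointwise bound for `Φ`** on `Re s₂ ∈ (0,1]`: `|Φ(s₂)| ≤ B K(θ,σ₂) R^{θ+σ₂} (π/θ^{u+a}) / |s₂|^{v+1+b}`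
(`a + u ≥ 1`, `|G(θ+it₁, s₂)| ≤ B`). [cite: GoldstonPintzYildirim2009, Section 8 eq. 8.6] -/
theorem norm_lemma3Phi_le {R : ℝ} (hR : 0 < R) {a b d u v : ℕ} (hau : 1 ≤ a + u) {θ B : ℝ}
    (hθ : 0 < θ) (hθ1 : θ ≤ 1) (hB0 : 0 ≤ B) {s₂ : ℂ} (h2 : 0 < s₂.re) (h2' : s₂.re ≤ 1)
    (hGB : ∀ t₁ : ℝ, ‖G ((θ : ℂ) + t₁ * I) s₂‖ ≤ B) :
    ‖lemma3Phi G R a b d u v θ s₂‖ ≤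
      B * lineConst θ s₂.re a b d * R ^ (θ + s₂.re) * (Real.pi / θ ^ (u + a)) * (‖s₂‖ ^ (v + 1 + b))⁻¹ := by
  obtain ⟨hint, hval⟩ := integral_inv_norm_pow_le hθ (k := u + a) (by omega)
  set K := B * lineConst θ s₂.re a b d * R ^ (θ + s₂.re) * (‖s₂‖ ^ (v + 1 + b))⁻¹ with hK
  have hK0 : 0 ≤ K := by rw [hK]; have := lineConst_nonneg hθ h2 a b d; positivity
  unfold lemma3Phi
  calc ‖∫ t₁ : ℝ, lemma3F G R a b d u v ((θ : ℂ) + t₁ * I) s₂‖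
      ≤ ∫ t₁ : ℝ, K * (‖(θ : ℂ) + t₁ * I‖ ^ (u + a + 1))⁻¹ := by
        refine norm_integral_le_of_norm_le (hint.const_mul K) (Eventually.of_forall fun t₁ => ?_)
        have h := norm_lemma3F_le_of_re_pos (G := G) (B := B) hR a b d u v (s₁ := (θ : ℂ) + t₁ * I) (s₂ := s₂)
          (by simp [hθ]) (by simp [hθ1]) h2 h2' hB0 (hGB t₁)
        simp only [Literature.NumberTheory.LFunctions.MertensBoundRH.re_line] at h
        rw [show u + 1 + a = u + a + 1 by ring] at h
        refine h.trans (le_of_eq ?_)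
        rw [hK]; ring
    _ = K * ∫ t₁ : ℝ, (‖(θ : ℂ) + t₁ * I‖ ^ (u + a + 1))⁻¹ := integral_const_mul _ _
    _ ≤ K * (Real.pi / θ ^ (u + a)) := mul_le_mul_of_nonneg_left hval hK0
    _ = _ := by rw [hK]; ring

/-- **Truncation of the outer integral** (`T ≥ 1`, `b + v ≥ 1`):
`‖∫_ℝ Φ(θ+it₂)dt₂ − ∫_{−T}^{T} Φ(θ+it₂)dt₂‖ ≤ 2 M_Φ/T`, `M_Φ = B K(θ,θ) R^{2θ} π/θ^{u+a}`.
[cite: GoldstonPintzYildirim2009, Section 8 eq. 8.6] -/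
theorem norm_Et_le (hG : DifferentiableOn ℂ (fun z : ℂ × ℂ => G z.1 z.2) G₂Region)
    {R : ℝ} (hR : 0 < R) {a b d u v : ℕ} (hau : 1 ≤ a + u) (hbv : 1 ≤ b + v) {θ B T : ℝ}
    (hθ : 0 < θ) (hθ1 : θ ≤ 1) (hB0 : 0 ≤ B) (hT : 1 ≤ T)
    (hGB : ∀ t₁ t₂ : ℝ, ‖G ((θ : ℂ) + t₁ * I) ((θ : ℂ) + t₂ * I)‖ ≤ B) :
    ‖(∫ t₂ : ℝ, lemma3Phi G R a b d u v θ ((θ : ℂ) + t₂ * I)) -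
        ∫ t₂ : ℝ in (-T)..T, lemma3Phi G R a b d u v θ ((θ : ℂ) + t₂ * I)‖ ≤
      2 * (B * lineConst θ θ a b d * R ^ (θ + θ) * (Real.pi / θ ^ (u + a)) / T) := by
  refine norm_integral_sub_intervalIntegral_le (integrable_lemma3Phi_line hG hR hau hbv hθ hθ1 hB0 hGB)
    (by linarith) fun t ht => ?_
  have ht1 : 1 ≤ |t| := hT.trans ht
  have h := norm_lemma3Phi_le (G := G) (b := b) (d := d) (v := v) hR hau hθ hθ1 hB0
    (s₂ := (θ : ℂ) + t * I) (by simp [hθ]) (by simp [hθ1]) (fun t₁ => hGB t₁ t)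
  simp only [Literature.NumberTheory.LFunctions.MertensBoundRH.re_line] at h
  refine h.trans ?_
  have hM0 : 0 ≤ B * lineConst θ θ a b d * R ^ (θ + θ) * (Real.pi / θ ^ (u + a)) := by
    have := lineConst_nonneg hθ hθ a b d; positivity
  rw [div_eq_mul_inv _ (t ^ 2)]
  refine mul_le_mul_of_nonneg_left ?_ hM0
  have hn : |t| ≤ ‖(θ : ℂ) + t * I‖ := by simpa using Complex.abs_im_le_norm ((θ : ℂ) + t * I)
  have ht0 : 0 < |t| := by linarith
  calc (‖(θ : ℂ) + t * I‖ ^ (v + 1 + b))⁻¹ ≤ (|t| ^ (v + 1 + b))⁻¹ :=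
        inv_anti₀ (by positivity) (pow_le_pow_left₀ (abs_nonneg t) hn _)
    _ ≤ (|t| ^ 2)⁻¹ := inv_anti₀ (by positivity) (pow_le_pow_right₀ ht1 (by omega))
    _ = (t ^ 2)⁻¹ := by rw [sq_abs]

/-! ### The residue `ρ₀` on the outer rectangle -/

/-- **Pointwise bound for `F` with `s₁ ∈ ∂Q(0,η)`** (`η ≤ |s₁| ≤ 2η`, `|Re s₁| ≤ η`, `2η ≤ ρ_W`) and
`s₂` with `|s₂| ≥ 4η`, `−σ₀ ≤ Re s₂ ≤ 1`, `|Im s₂| ≤ T`, in the zero-free region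
(`σ₀ + η ≤ 4c̄/log(T + η + 3)`), `|G| ≤ B` on `−κ ≤ Re sᵢ ≤ 2` (`σ₀, η ≤ κ`), `R ≥ 1`:
`|F(s₁,s₂)| ≤ B (1/(2η) + Cℓ)^d (4η)^a (Cℓ)^b R^{η+Re s₂} / (η^{u+1+a} |s₂|^{v+1+b})`,
`ℓ = log(T+η+3)`. [cite: GoldstonPintzYildirim2009, Section 8 eq. 8.16] -/
theorem norm_lemma3F_shell_le
    (hWz : ∀ z : ℂ, z ≠ 0 → -(4 * cbar / Real.log (|z.im| + 3)) ≤ z.re →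
      zetaOne z ≠ 0 ∧ ‖(zetaOne z)⁻¹‖ ≤ C * Real.log (|z.im| + 3) / ‖z‖ ∧
        ‖zetaOne z‖ ≤ 1 + C * ‖z‖ * Real.log (|z.im| + 3))
    (hc : 0 ≤ cbar) (hC : 0 ≤ C) {B κ ρW : ℝ} (hB0 : 0 ≤ B)
    (hGB : ∀ s₁ s₂ : ℂ, -κ ≤ s₁.re → s₁.re ≤ 2 → -κ ≤ s₂.re → s₂.re ≤ 2 → ‖G s₁ s₂‖ ≤ B)
    (hρ : ∀ s : ℂ, ‖s‖ ≤ ρW → 1 / 2 ≤ ‖zetaOne s‖ ∧ ‖zetaOne s‖ ≤ 3 / 2)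
    {R : ℝ} (hR : 1 ≤ R) (a b d u v : ℕ) {η σ₀ T : ℝ} {s₁ s₂ : ℂ} (hη : 0 < η) (hη1 : η ≤ 1)
    (hηρ : 2 * η ≤ ρW)
    (hηκ : η ≤ κ) (hσκ : σ₀ ≤ κ) (hT : 0 ≤ T) (hzfr : σ₀ + η ≤ 4 * cbar / Real.log (T + η + 3))
    (h1lo : η ≤ ‖s₁‖) (h1hi : ‖s₁‖ ≤ 2 * η) (h1re : |s₁.re| ≤ η) (h1im : |s₁.im| ≤ η)
    (h2 : 4 * η ≤ ‖s₂‖) (h2lo : -σ₀ ≤ s₂.re) (h2hi : s₂.re ≤ 1) (h2im : |s₂.im| ≤ T) :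
    ‖lemma3F G R a b d u v s₁ s₂‖ ≤
      B * (1 / (2 * η) + C * Real.log (T + η + 3)) ^ d * (4 * η) ^ a * (C * Real.log (T + η + 3)) ^ b *
        R ^ (η + s₂.re) * ((η ^ (u + 1 + a))⁻¹ * (‖s₂‖ ^ (v + 1 + b))⁻¹) := by
  have hs1ne : s₁ ≠ 0 := fun h => by rw [h, norm_zero] at h1lo; linarith
  have hs2ne : s₂ ≠ 0 := fun h => by rw [h, norm_zero] at h2; linarith
  have h12n : 2 * η ≤ ‖s₁ + s₂‖ := by
    have h := norm_sub_norm_le s₂ (-s₁)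
    rw [norm_neg, sub_neg_eq_add, add_comm s₂ s₁] at h
    linarith
  have hs12 : s₁ + s₂ ≠ 0 := fun h => by rw [h, norm_zero] at h12n; linarith
  have hlog : 0 < Real.log (T + η + 3) := Real.log_pos (by linarith)
  -- `W(s₁)`: `‖s₁‖ ≤ ρ_W`
  have hW1' : 1 / 2 ≤ ‖zetaOne s₁‖ := (hρ s₁ (by linarith)).1
  have hW1 : zetaOne s₁ ≠ 0 := fun h => by rw [h, norm_zero] at hW1'; linarith
  have hA1 : ‖(zetaOne s₁)⁻¹‖ ≤ (4 * η) / ‖s₁‖ := by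
    have hinv : ‖(zetaOne s₁)⁻¹‖ ≤ 2 := by
      rw [norm_inv]; exact inv_le_of_inv_le₀ (by norm_num) (by linarith)
    have h2le : (2 : ℝ) ≤ 4 * η / ‖s₁‖ := by rw [le_div_iff₀ (by linarith)]; linarith
    exact hinv.trans h2le
  -- `W(s₁+s₂)`: zero-free region at height `T + η`
  have h1re' := abs_le.1 h1re
  have hzY : |(s₁ + s₂).im| ≤ T + η := by
    rw [add_im]
    calc |s₁.im + s₂.im| ≤ |s₁.im| + |s₂.im| := abs_add_le _ _
      _ ≤ T + η := by linarith
  obtain ⟨-, -, hZ⟩ := zetaOne_bounds_of_height_le hWz hc hC hs12 hzY (by rw [add_re]; linarith)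
  have hZ' : ‖zetaOne (s₁ + s₂)‖ / ‖s₁ + s₂‖ ≤ 1 / (2 * η) + C * Real.log (T + η + 3) := by
    refine hZ.trans ?_
    have : 1 / ‖s₁ + s₂‖ ≤ 1 / (2 * η) := one_div_le_one_div_of_le (by linarith) h12n
    linarith
  -- `W(s₂)`: zero-free region at height `T ≤ T + η`
  obtain ⟨hW2, hA2, -⟩ := zetaOne_bounds_of_height_le hWz hc hC hs2ne (Y := T + η)
    (by linarith) (by linarith)
  have hGB' : ‖G s₁ s₂‖ ≤ B := hGB s₁ s₂ (by linarith) (by linarith) (by linarith) (by linarith)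
  have hmaster := norm_lemma3F_le_master (G := G) (R := R) (by linarith) a b d u v hs1ne hs2ne hs12
    hW1 hW2 hB0 (by positivity) (by positivity) hGB' hZ' hA1 hA2
  refine hmaster.trans ?_
  have hRle : R ^ (s₁.re + s₂.re) ≤ R ^ (η + s₂.re) := Real.rpow_le_rpow_of_exponent_le hR (by linarith)
  have hpow : (‖s₁‖ ^ (u + 1 + a))⁻¹ ≤ (η ^ (u + 1 + a))⁻¹ :=
    inv_anti₀ (by positivity) (pow_le_pow_left₀ hη.le h1lo _)
  have hK0 : 0 ≤ B * (1 / (2 * η) + C * Real.log (T + η + 3)) ^ d * (4 * η) ^ a *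
      (C * Real.log (T + η + 3)) ^ b := by positivity
  gcongr

/-- **Pointwise bound for `ρ₀`** under the hypotheses of `norm_lemma3F_shell_le` on `s₂`:
`|ρ₀(s₂)| ≤ 8η · B (1/(2η) + Cℓ)^d (4η)^a (Cℓ)^b R^{η+Re s₂} / (η^{u+1+a} |s₂|^{v+1+b})`.
[cite: GoldstonPintzYildirim2009, Section 8 eq. 8.16] -/
theorem norm_zeroRes_le
    (hWz : ∀ z : ℂ, z ≠ 0 → -(4 * cbar / Real.log (|z.im| + 3)) ≤ z.re →
      zetaOne z ≠ 0 ∧ ‖(zetaOne z)⁻¹‖ ≤ C * Real.log (|z.im| + 3) / ‖z‖ ∧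
        ‖zetaOne z‖ ≤ 1 + C * ‖z‖ * Real.log (|z.im| + 3))
    (hc : 0 ≤ cbar) (hC : 0 ≤ C) {B κ ρW : ℝ} (hB0 : 0 ≤ B)
    (hGB : ∀ s₁ s₂ : ℂ, -κ ≤ s₁.re → s₁.re ≤ 2 → -κ ≤ s₂.re → s₂.re ≤ 2 → ‖G s₁ s₂‖ ≤ B)
    (hρ : ∀ s : ℂ, ‖s‖ ≤ ρW → 1 / 2 ≤ ‖zetaOne s‖ ∧ ‖zetaOne s‖ ≤ 3 / 2)
    {R : ℝ} (hR : 1 ≤ R) (a b d u v : ℕ) {η σ₀ T : ℝ} {s₂ : ℂ} (hη : 0 < η) (hη1 : η ≤ 1)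
    (hηρ : 2 * η ≤ ρW)
    (hηκ : η ≤ κ) (hσκ : σ₀ ≤ κ) (hT : 0 ≤ T) (hzfr : σ₀ + η ≤ 4 * cbar / Real.log (T + η + 3))
    (h2 : 4 * η ≤ ‖s₂‖) (h2lo : -σ₀ ≤ s₂.re) (h2hi : s₂.re ≤ 1) (h2im : |s₂.im| ≤ T) :
    ‖zeroRes G R a b d u v η s₂‖ ≤
      8 * η * (B * (1 / (2 * η) + C * Real.log (T + η + 3)) ^ d * (4 * η) ^ a *
        (C * Real.log (T + η + 3)) ^ b * R ^ (η + s₂.re) * ((η ^ (u + 1 + a))⁻¹ * (‖s₂‖ ^ (v + 1 + b))⁻¹)) := by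
  have hpt : ∀ s₁ : ℂ, ((s₁.re ∈ Icc (-η) η ∧ (s₁.im = -η ∨ s₁.im = η)) ∨
      (s₁.im ∈ Icc (-η) η ∧ (s₁.re = -η ∨ s₁.re = η))) →
      ‖lemma3F G R a b d u v s₁ s₂‖ ≤
        B * (1 / (2 * η) + C * Real.log (T + η + 3)) ^ d * (4 * η) ^ a * (C * Real.log (T + η + 3)) ^ b *
          R ^ (η + s₂.re) * ((η ^ (u + 1 + a))⁻¹ * (‖s₂‖ ^ (v + 1 + b))⁻¹) := by
    intro s₁ hs₁
    obtain ⟨h1lo, h1hi, h1re, h1im⟩ := square_boundary_norms hη hs₁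
    exact norm_lemma3F_shell_le hWz hc hC hB0 hGB hρ hR a b d u v hη hη1 hηρ hηκ hσκ hT hzfr h1lo h1hi h1re
      h1im h2 h2lo h2hi h2im
  have h := Literature.Analysis.Complex.norm_rectBoundaryIntegral_le (F := fun s₁ => lemma3F G R a b d u v s₁ s₂)
    (a := -η) (b := η) (c := -η) (d := η) (by linarith) (by linarith)
    (fun x hx => hpt _ (Or.inl ⟨by simpa using hx, Or.inl (by simp)⟩))
    (fun x hx => hpt _ (Or.inl ⟨by simpa using hx, Or.inr (by simp)⟩))
    (fun y hy => hpt _ (Or.inr ⟨by simpa using hy, Or.inl (by simp)⟩))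
    (fun y hy => hpt _ (Or.inr ⟨by simpa using hy, Or.inr (by simp)⟩))
  unfold zeroRes
  refine h.trans (le_of_eq ?_)
  ring

/-- **`ρ₀` on the left edge `Re s₂ = −σ₀`** (`4η ≤ σ₀ ≤ 1`, `b + v ≥ 1`):
`‖∫_{−T}^{T} ρ₀(−σ₀+it) dt‖ ≤ 8η B (1/(2η)+Cℓ)^d (4η)^a (Cℓ)^b R^{η−σ₀} η^{−(u+1+a)} · π/σ₀^{v+b}`.
[cite: GoldstonPintzYildirim2009, Section 8 eq. 8.19] -/
theorem norm_integral_zeroRes_left_le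
    (hWz : ∀ z : ℂ, z ≠ 0 → -(4 * cbar / Real.log (|z.im| + 3)) ≤ z.re →
      zetaOne z ≠ 0 ∧ ‖(zetaOne z)⁻¹‖ ≤ C * Real.log (|z.im| + 3) / ‖z‖ ∧
        ‖zetaOne z‖ ≤ 1 + C * ‖z‖ * Real.log (|z.im| + 3))
    (hc : 0 ≤ cbar) (hC : 0 ≤ C) {B κ ρW : ℝ} (hB0 : 0 ≤ B)
    (hGB : ∀ s₁ s₂ : ℂ, -κ ≤ s₁.re → s₁.re ≤ 2 → -κ ≤ s₂.re → s₂.re ≤ 2 → ‖G s₁ s₂‖ ≤ B)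
    (hρ : ∀ s : ℂ, ‖s‖ ≤ ρW → 1 / 2 ≤ ‖zetaOne s‖ ∧ ‖zetaOne s‖ ≤ 3 / 2)
    {R : ℝ} (hR : 1 ≤ R) {a b d u v : ℕ} (hbv : 1 ≤ b + v) {η σ₀ T : ℝ} (hη : 0 < η) (hη1 : η ≤ 1)
    (hηρ : 2 * η ≤ ρW)
    (hηκ : η ≤ κ) (hσκ : σ₀ ≤ κ) (hσ₀ : 4 * η ≤ σ₀) (hσ₀1 : σ₀ ≤ 1) (hT : 0 ≤ T)
    (hzfr : σ₀ + η ≤ 4 * cbar / Real.log (T + η + 3)) :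
    ‖∫ t : ℝ in (-T)..T, zeroRes G R a b d u v η (((-σ₀ : ℝ) : ℂ) + t * I)‖ ≤
      8 * η * (B * (1 / (2 * η) + C * Real.log (T + η + 3)) ^ d * (4 * η) ^ a *
        (C * Real.log (T + η + 3)) ^ b * R ^ (η + -σ₀) * (η ^ (u + 1 + a))⁻¹) * (Real.pi / σ₀ ^ (v + b)) := by
  have hσ₀0 : 0 < σ₀ := by linarith
  obtain ⟨hint, hval⟩ := integral_inv_norm_pow_le hσ₀0 (k := v + b) (by omega)
  set K := 8 * η * (B * (1 / (2 * η) + C * Real.log (T + η + 3)) ^ d * (4 * η) ^ a *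
    (C * Real.log (T + η + 3)) ^ b * R ^ (η + -σ₀) * (η ^ (u + 1 + a))⁻¹) with hK
  have hlog : 0 < Real.log (T + η + 3) := Real.log_pos (by linarith)
  have hK0 : 0 ≤ K := by rw [hK]; positivity
  -- `‖−σ₀ + it‖ = ‖σ₀ + it‖`
  have hnorm : ∀ t : ℝ, ‖(((-σ₀ : ℝ) : ℂ) + t * I)‖ = ‖((σ₀ : ℂ) + t * I)‖ := by
    intro t
    have hsq : ‖(((-σ₀ : ℝ) : ℂ) + t * I)‖ ^ 2 = ‖((σ₀ : ℂ) + t * I)‖ ^ 2 := by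
      rw [Complex.sq_norm, Complex.sq_norm, Complex.normSq_apply, Complex.normSq_apply]; simp
    rw [← Real.sqrt_sq (norm_nonneg (((-σ₀ : ℝ) : ℂ) + t * I)), hsq, Real.sqrt_sq (norm_nonneg _)]
  calc _ ≤ ∫ t : ℝ in (-T)..T, K * (‖(σ₀ : ℂ) + t * I‖ ^ (v + b + 1))⁻¹ := by
        refine intervalIntegral.norm_integral_le_of_norm_le (by linarith) (Eventually.of_forall fun t ht => ?_)
          ((hint.const_mul K).intervalIntegrable)
        have hre_le : σ₀ ≤ ‖((σ₀ : ℂ) + t * I)‖ := by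
          have h := Complex.abs_re_le_norm ((σ₀ : ℂ) + t * I)
          rwa [Literature.NumberTheory.LFunctions.MertensBoundRH.re_line, abs_of_pos hσ₀0] at h
        have h := norm_zeroRes_le hWz hc hC hB0 hGB hρ hR a b d u v (s₂ := ((-σ₀ : ℝ) : ℂ) + t * I) hη hη1 hηρ
          hηκ hσκ hT hzfr (by rw [hnorm]; exact hσ₀.trans hre_le)
          (by simp) (by simp; linarith) (by simpa using abs_le.2 ⟨ht.1.le, ht.2⟩)
        simp only [Literature.NumberTheory.LFunctions.MertensBoundRH.re_line] at h
        rw [hnorm t, show v + 1 + b = v + b + 1 by ring] at h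
        refine h.trans (le_of_eq ?_)
        rw [hK]; ring
    _ ≤ ∫ t : ℝ, K * (‖(σ₀ : ℂ) + t * I‖ ^ (v + b + 1))⁻¹ := by
        rw [intervalIntegral.integral_of_le (by linarith)]
        exact setIntegral_le_integral (hint.const_mul K) (Eventually.of_forall fun t => by positivity)
    _ = K * ∫ t : ℝ, (‖(σ₀ : ℂ) + t * I‖ ^ (v + b + 1))⁻¹ := integral_const_mul _ _
    _ ≤ K * (Real.pi / σ₀ ^ (v + b)) := mul_le_mul_of_nonneg_left hval hK0

/-- **`ρ₀` on the horizontal connectors `Im s₂ = ±T`**, `Re s₂ ∈ [−σ₀, θ]` (`T ≥ 4η`, `θ ≤ 1`,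
`σ₀ + θ ≤ 1`...): `‖∫_{−σ₀}^{θ} ρ₀(x ± iT) dx‖ ≤ (θ+σ₀) 8η B (1/(2η)+Cℓ)^d (4η)^a (Cℓ)^b R^{η+θ} η^{−(u+1+a)} T^{−(v+1+b)}`.
[cite: GoldstonPintzYildirim2009, Section 8 eq. 8.17] -/
theorem norm_integral_zeroRes_horizontal_le
    (hWz : ∀ z : ℂ, z ≠ 0 → -(4 * cbar / Real.log (|z.im| + 3)) ≤ z.re →
      zetaOne z ≠ 0 ∧ ‖(zetaOne z)⁻¹‖ ≤ C * Real.log (|z.im| + 3) / ‖z‖ ∧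
        ‖zetaOne z‖ ≤ 1 + C * ‖z‖ * Real.log (|z.im| + 3))
    (hc : 0 ≤ cbar) (hC : 0 ≤ C) {B κ ρW : ℝ} (hB0 : 0 ≤ B)
    (hGB : ∀ s₁ s₂ : ℂ, -κ ≤ s₁.re → s₁.re ≤ 2 → -κ ≤ s₂.re → s₂.re ≤ 2 → ‖G s₁ s₂‖ ≤ B)
    (hρ : ∀ s : ℂ, ‖s‖ ≤ ρW → 1 / 2 ≤ ‖zetaOne s‖ ∧ ‖zetaOne s‖ ≤ 3 / 2)
    {R : ℝ} (hR : 1 ≤ R) (a b d u v : ℕ) {η σ₀ θ T : ℝ} (hη : 0 < η) (hη1 : η ≤ 1) (hηρ : 2 * η ≤ ρW)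
    (hηκ : η ≤ κ) (hσκ : σ₀ ≤ κ) (hθ1 : θ ≤ 1) (hσθ : -σ₀ ≤ θ) (hT : 4 * η ≤ T)
    (hzfr : σ₀ + η ≤ 4 * cbar / Real.log (T + η + 3)) {Y : ℝ} (hY : |Y| = T) :
    ‖∫ x : ℝ in (-σ₀)..θ, zeroRes G R a b d u v η ((x : ℂ) + (Y : ℂ) * I)‖ ≤
      (θ + σ₀) * (8 * η * (B * (1 / (2 * η) + C * Real.log (T + η + 3)) ^ d * (4 * η) ^ a *
        (C * Real.log (T + η + 3)) ^ b * R ^ (η + θ) * ((η ^ (u + 1 + a))⁻¹ * (T ^ (v + 1 + b))⁻¹))) := by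
  have hT0 : 0 < T := by linarith
  have hlog : 0 < Real.log (T + η + 3) := Real.log_pos (by linarith)
  have h := intervalIntegral.norm_integral_le_of_norm_le_const (a := -σ₀) (b := θ)
    (f := fun x : ℝ => zeroRes G R a b d u v η ((x : ℂ) + (Y : ℂ) * I))
    (C := 8 * η * (B * (1 / (2 * η) + C * Real.log (T + η + 3)) ^ d * (4 * η) ^ a *
        (C * Real.log (T + η + 3)) ^ b * R ^ (η + θ) * ((η ^ (u + 1 + a))⁻¹ * (T ^ (v + 1 + b))⁻¹)))
    (fun x hx => by
      rw [uIoc_of_le hσθ] at hx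
      have hnT : T ≤ ‖(x : ℂ) + (Y : ℂ) * I‖ := by
        have := Complex.abs_im_le_norm ((x : ℂ) + (Y : ℂ) * I); simp at this; rwa [hY] at this
      have h := norm_zeroRes_le hWz hc hC hB0 hGB hρ hR a b d u v (s₂ := (x : ℂ) + (Y : ℂ) * I) hη hη1 hηρ hηκ
        hσκ hT0.le hzfr (hT.trans hnT) (by simp; exact hx.1.le) (by simp; linarith [hx.2])
        (by simp [hY])
      refine h.trans ?_
      simp only [add_re, ofReal_re, mul_re, I_re, mul_zero, ofReal_im, I_im, mul_one, sub_self, add_zero]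
      have hRx : R ^ (η + x) ≤ R ^ (η + θ) := Real.rpow_le_rpow_of_exponent_le hR (by linarith [hx.2])
      have hpow : (‖(x : ℂ) + (Y : ℂ) * I‖ ^ (v + 1 + b))⁻¹ ≤ (T ^ (v + 1 + b))⁻¹ :=
        inv_anti₀ (by positivity) (pow_le_pow_left₀ hT0.le hnT _)
      have hK0 : 0 ≤ 8 * η * (B * (1 / (2 * η) + C * Real.log (T + η + 3)) ^ d * (4 * η) ^ a *
          (C * Real.log (T + η + 3)) ^ b) := by positivity
      calc 8 * η * (B * (1 / (2 * η) + C * Real.log (T + η + 3)) ^ d * (4 * η) ^ a *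
            (C * Real.log (T + η + 3)) ^ b * R ^ (η + x) *
            ((η ^ (u + 1 + a))⁻¹ * (‖(x : ℂ) + (Y : ℂ) * I‖ ^ (v + 1 + b))⁻¹))
          = 8 * η * (B * (1 / (2 * η) + C * Real.log (T + η + 3)) ^ d * (4 * η) ^ a *
            (C * Real.log (T + η + 3)) ^ b) * (R ^ (η + x) *
            ((η ^ (u + 1 + a))⁻¹ * (‖(x : ℂ) + (Y : ℂ) * I‖ ^ (v + 1 + b))⁻¹)) := by ring
        _ ≤ 8 * η * (B * (1 / (2 * η) + C * Real.log (T + η + 3)) ^ d * (4 * η) ^ a *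
            (C * Real.log (T + η + 3)) ^ b) * (R ^ (η + θ) *
            ((η ^ (u + 1 + a))⁻¹ * (T ^ (v + 1 + b))⁻¹)) := by
            refine mul_le_mul_of_nonneg_left ?_ hK0
            gcongr
        _ = _ := by ring)
  rw [abs_of_nonneg (by linarith : (0 : ℝ) ≤ θ - -σ₀)] at h
  refine h.trans (le_of_eq ?_)
  ring

end Pieces

end Literature.NumberTheory.Sieve.GPY
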